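import Summits.QuantumFields.YangMills.Theses.UnitScaleTilt
import Literature.MathematicalPhysics.QuantumFieldTheory.Balaban1983to89.T3PrintedRegularMinimiser
import Literature.MathematicalPhysics.QuantumFieldTheory.Balaban1983to89.T3SmallLiftHistory
import Literature.MathematicalPhysics.QuantumFieldTheory.Balaban1983to89.T3AlphaInputsACTwoRun
import Summits.QuantumFields.YangMills.Theorems.UnitScaleTiltFluctuationComparisonRegPrOneStepSubmersion
import Summits.QuantumFields.YangMills.Theorems.UnitScaleTiltFluctuationComparisonRegPrSocket
import Summits.QuantumFields.YangMills.Theorems.AlphaInputsT3AC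
import HarnessLib

/-!
# BC3 birth skeleton v5d = OWNER'S REGISTRATION CUT (ym3-torus-plan g16, 2026-08-26T19:3xZ; OWNER RULING g16-№1 = director R180-amended disposition
# (iii)(c) «per-stub L-hypotheses exactly where the stub's own typed content needs them + a rank-last small-L node», FINDING #44/#48/#56 disposed as
# R3-by-hypothesis on the large-L line and R1/R2′ reserved for the residue stub): ★p2's v5c PROPOSAL f82347ea01ccbb16 BYTE-IDENTICAL except
# (1) `stub_alphaTwoRunOfLane` — the one stub CONCLUDING the socket's full-V-window lower representation `RepAtHeights` — carries `7 ≤ L` (the typed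
# socket's consistency range: κ_min^{lin}(L)·√L = 1.66 / 1.08 / 0.72 at L = 3 / 5 / 7, kit j257288/j257395/j257483; NOT a print floor — letter (B)'s
# «> 11» and [B13] (2.36) bind nothing typed in this route, lit g10 19:03:13Z) instead of `1 < L`; (2) NEW rank-last STUB 6
# `stub_logComparisonSmallBlocks` = the v2–v4 registered stub-3 text on odd `L < 7`, i.e. L ∈ {3, 5}; (3) §2 `logComparisonRegPr` splits
# `by_cases 7 ≤ L`.  SIX stubs; `posOnSmall` / `FluctuationComparisonRegPr_of` byte-identical to v4/v5b/v5c.)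
# v5c (★ym-ust-19201-p2, 2026-08-26T18:0xZ; OWNER RULING g15-№2 (ii) + ADDENDUM l.342: FIVE stubs — `stub_oneStepSmallLift` (verbatim) · `stub_laneInputsT3` (v5.1 verbatim) · `stub_alphaTwoRunOfLane` (α⁺: the per-run package `T3AlphaInputsACSchemas.AlphaInputsT3AC D b₀ p₀ ε₀ C68` AND the two-run bundle `T3AlphaInputsACTwoRun.TwoRun D b₀ p₀ C68 a` delivered WITH the constructed D) · `stub_minimiserCauchy` (e1) · `stub_levelCauchyOfSchemas` (S-E″ bookkeeping incl. e5); 3b `stub_cauchyOfLocalRep` and the skeleton-local `GoodData` are GONE; §2 composition via `LogComparisonSocket.stubBody_of_rep_of_cauchy` (p452026); supersedes v5b af848c07476bf774 / v5.1 85a9657d2dce0076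
# crux `FluctuationComparisonRegPr` (route `UnitScaleTilt`, item stmt-QuantumFields-19201, K1bR-pr): STUB 3 `stub_logComparisonRegPr` RE-CUT
# THROUGH THE LANDED α INTERFACE `T3AlphaInputsAC` (p452599) AND THE LANDED SOCKET THEOREM `LogComparisonSocket.logComparisonRegPr_of_exists_data` (p452026)

= v4 (8bc2245c3551c7ca: `stub_oneStepSmallLift` byte-identical, `landed_oneStepSubmersion`, composition byte-identical) with `stub_logComparisonRegPr`
now a THEOREM from two registered stubs over the α interface:

* `stub_localRepOfLane` (XXL; IN PRINT FOR ONE RUN modulo the (α) inputs: [Balaban1985UV3] Thm 2 = (41)∧(47) at the trivial history for the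
  `ℰp`-pinned densities, with the interaction data LOCAL and SIZED, i.e. [Balaban1988Convergent]'s complete small-field expansion; = owner's
  «common pair» `stub_laneInputsT3 ∧ stub_alphaOfLane` MERGED until alpha-1's Summit-side `AtScaleT3AC` name exists — then split it by name, the
  composition below does not change): below a regularity threshold `ε₁(L)` and a coupling threshold `γ₁(L, ε₀, b₀, p₀)`, every family carries
  SOME `D : AlphaDataT3 F γ` with `IsLocal D`, `TermSize D b₀ p₀ C κ₁` for some constants, `Sizes D b₀ p₀`, and the two-sided representation at
  the heights `RepAtHeights D b₀ p₀ ε₀` (= ★p2's socket `TwoSidedRepAt` at `PintH/EcstH/RmH`).  consumes: every field of `D` the schemas name;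
  `D` may depend on `(ε₀, b₀, p₀)` (print's decomposition of unity uses the profile).
* `stub_cauchyOfLocalRep` (XXL, located-UNPRINTED for non-abelian d = 3 — [King1986] Thm 3.4 shape GIVEN local sized representations of both
  runs; = owner's S-E′): below thresholds of the same shape, with `m₀ = m₀(L, ε₀)` BEFORE `b₀ p₀ F γ D` (the registered «∃ m₀»; S-B's `m > 1 + β/γ′`
  with exponents functions of `L`), EVERY local sized datum with the two-sided representation satisfies `CauchyAtHeights D b₀ p₀ m` (= ★p2's socket
  `PintCauchyAt` at `PintH D`).  consumes: `IsLocal`, `TermSize`, `RepAtHeights` as hypotheses (rigidity, ★p1 g1 p452861: without locality the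
  statement would be the whole stub), `CauchyAtHeights` as conclusion.
`stub_logComparisonRegPr` := `logComparisonRegPr_of_exists_data PintH EcstH RmH Good stub_localRepOfLane stub_cauchyOfLocalRep` with
`Good D ε₀ b₀ p₀ := IsLocal D ∧ (∃ C κ₁, TermSize D b₀ p₀ C κ₁) ∧ Sizes D b₀ p₀` — NO sorry below §1; `FluctuationComparisonRegPr_of` byte-identical to v4.
Probes to run before registration (owner): stub → crux ×3, stub → `YM3TorusSU2` ×3, stub outright ×3 (trivial witnesses: `D` with `Pterm = 0`
fails `RepAtHeights`; `Rm := 0` data fail `IsLocal`-free? — no: locality is a property of `Pterm`, the envelope of `PintH`; a datum with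
`Pint := log ρ + bg` is NOT local, which is the point of the cut).
-/

set_option autoImplicit false

noncomputable section

namespace Summit.QuantumFields.YangMills.Cruxes.FluctuationComparisonRegPr.BirthV5d

open MeasureTheory Filter Topology
open Literature.MathematicalPhysics.QuantumFieldTheory.Balaban1983to89
open Literature.MathematicalPhysics.QuantumFieldTheory.Balaban1983to89.T3ContinuumYM3Torus
open Literature.MathematicalPhysics.QuantumFieldTheory.Balaban1983to89.T3LevelShift
open Literature.MathematicalPhysics.QuantumFieldTheory.Balaban1983to89.T3UnitLawDensityEML (ℰp measurableE_ℰp)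
open Literature.MathematicalPhysics.QuantumFieldTheory.Balaban1983to89.T3UnitScaleTilt
open Literature.MathematicalPhysics.QuantumFieldTheory.Balaban1983to89.T3RestrictedUnitDensity
open Literature.MathematicalPhysics.QuantumFieldTheory.Balaban1983to89.T3TiltDescent
open Literature.MathematicalPhysics.QuantumFieldTheory.Balaban1983to89.T3ConstrainedMinimiser
open Literature.MathematicalPhysics.QuantumFieldTheory.Balaban1983to89.T3RegularMinimiser
open Literature.MathematicalPhysics.QuantumFieldTheory.Balaban1983to89.T3PrintedRegularMinimiser
open Literature.MathematicalPhysics.QuantumFieldTheory.Balaban1983to89.T3SmallLiftHistory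
open Literature.MathematicalPhysics.QuantumFieldTheory.Balaban1983to89.T3LogComparisonSocket
open Literature.MathematicalPhysics.QuantumFieldTheory.Balaban1983to89.T3AlphaInputsAC
open Literature.MathematicalPhysics.QuantumFieldTheory.Balaban1983to89.T3AlphaInputsACTwoRun
open Literature.MathematicalPhysics.QuantumFieldTheory.Balaban1983to89.Missing
open Literature.MathematicalPhysics.QuantumFieldTheory.Balaban1983to89.T4Continuum

/-! ## §1 Registered stubs (sorries live ONLY here) -/

/-- STUB 1 (L; W7) — ONE-STEP SMALL LIFT with gain `κ√L ≤ 1` for every family of block size `L` (linearisation certified; non-linear step =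
implicit function on `SU(2)^{bonds}`). [cite: Balaban1987RG1, (0.4)/(0.18) p.253] -/
theorem stub_oneStepSmallLift :
    ∀ L : ℕ, ∃ κ δ₀ : ℝ, κ * Real.sqrt L ≤ 1 ∧ 0 < δ₀ ∧
      ∀ F : T3Family, F.L = L → OneStepSmallLift F ℰp κ δ₀ := by
  sorry

/-- LANDED (was STUB 2 of v3, `stub_oneStepSubmersion`): the ONE-STEP SUBMERSION (O) ∧ (N) of the (0.4)/EML averaging on small `SU(2)`
fields — PROVED by the fleet lead ym-ust-19201-p1, `Theorems.OneStepSubmersion.oneStepSubmersion_family` (p446430; engines p443878 fibrewise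
submersion, p444734/p445163 parametric IFT on `SU(2)` in the cone picture, p445817 analytic datum of the EML fibre map).  Renamed `landed_…` so the
registrar does not resurrect it as a stub (cf. 19200 v3d). [cite: Balaban1987RG1, (0.4) p.253] -/
theorem landed_oneStepSubmersion :
    ∀ L : ℕ, ∃ δ₁ : ℝ, 0 < δ₁ ∧ ∀ F : T3Family, F.L = L → ∀ K j : ℕ, j + 1 ≤ F.m + K →
      (∀ O : Set (GaugeField (F.P K) j (Matrix.specialUnitaryGroup (Fin 2) ℂ)), IsOpen O → O ⊆ {U | PlaqSmall δ₁ U} →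
        IsOpen ((BlockAveraging.blockAvg (P := F.P K) (j := j) ℰp).avg '' O)) ∧
      (∀ O : Set (GaugeField (F.P K) j (Matrix.specialUnitaryGroup (Fin 2) ℂ)), IsOpen O → O ⊆ {U | PlaqSmall δ₁ U} →
        ∀ A : Set (GaugeField (F.P K) (j + 1) (Matrix.specialUnitaryGroup (Fin 2) ℂ)), MeasurableSet A →
          fieldMeasure (F.P K) j (Matrix.specialUnitaryGroup (Fin 2) ℂ)
              (O ∩ (BlockAveraging.blockAvg (P := F.P K) (j := j) ℰp).avg ⁻¹' A) = 0 →
            fieldMeasure (F.P K) (j + 1) (Matrix.specialUnitaryGroup (Fin 2) ℂ)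
              (A ∩ (BlockAveraging.blockAvg (P := F.P K) (j := j) ℰp).avg '' O) = 0) :=
  Summit.QuantumFields.YangMills.Theorems.OneStepSubmersion.oneStepSubmersion_family

/-- STUB 3a₁ (XXL; = the owner's `stub_laneInputsT3`, g15-№1 (4); IN PRINT modulo Bałaban CMP 95–99/102 = NODE O's object at d = 3) — BAŁABAN'S (α) INPUT
PACKAGE HOLDS FOR THE PINNED CARRIER at every admissible block size: alpha-1's Summit-side closed proposition `Theorems.AlphaInputsT3AC L` (p453618: ONE
primitive-constants record `𝔠 : AlphaConsts L 2` such that every family with `F.L = L` satisfies `AlphaInputsT3AC.Of F 𝔠` — the AC (α) rows at the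
`blockAvg ℰp`-pinned tower). [cite: Balaban1985UV3, Thm 1 p.257 and Thm 2 p.272] -/
theorem stub_laneInputsT3 :
    ∀ (L : ℕ), Odd L → 1 < L → Summit.QuantumFields.YangMills.Theorems.AlphaInputsT3AC L := by
  sorry

/-- STUB 3a₂ = α⁺ (XXL, THE CORE; owner's `stub_alphaTwoRunOfLane`; hypothesis `7 ≤ L` — owner ruling g16-№1: the one stub of this skeleton whose
CONCLUSION carries the socket's full-V-window, all-heights lower representation `RepAtHeights` (window `PlaqSmall (θBal n) V` on the data, where print's
(47) p.267 carries χ_k on the minimiser), which together with `IsLocal ∧ TermSize` is unsatisfiable on the window's edge band at L = 3 (κ_min^{lin}·√3 = 1.66)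
and L = 5 (1.08) and consistent for L ≥ 7 (0.72 — FINDING #44/#48/#56, kit j257288/j257395/j257483/j257805/j257906); odd L ∈ {3, 5} is STUB 6; the token
is OUR TYPING'S consistency range, not print's letter: CMP 95–102 take «L = 2 or 3» and no display used by this route invokes [B13] (2.36) — lit g10
19:03:13Z/19:09:41Z): FROM THE (α) ROWS OF ONE CONSTANTS RECORD, for every family of that block size
below thresholds `ε₁(L, 𝔠)`, `γ₁(L, 𝔠, ε₀, b₀, p₀)` and with ONE exponent `a(L, 𝔠) > 0`: a datum `D : AlphaDataT3 F γ` satisfying the landed per-run PACKAGE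
`T3AlphaInputsACSchemas.AlphaInputsT3AC D b₀ p₀ ε₀ C68` (Bałaban Thm 2 = (41)∧(47) for the ℰp runs, local sized data, §6 anti-junk clauses, `RepAtHeights`;
[Balaban1985UV3] Thm 2 p.272, [Balaban1988Convergent] §0) AND the two-run bundle `T3AlphaInputsACTwoRun.TwoRun D b₀ p₀ C68 a` (King's matched-step
activity replacement FOR THAT CONSTRUCTION — [King1986] §3.4–3.5 pp.664–665, Props 3.8–3.10; located, UNPRINTED for non-abelian d = 3).
[cite: Balaban1985UV3, Thm 2 p.272; King1986, Prop. 3.8-3.9 pp.664-665] -/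
theorem stub_alphaTwoRunOfLane :
    ∀ (L : ℕ), Odd L → 7 ≤ L → ∀ 𝔠 : Summit.QuantumFields.Balaban3D.Proofs.Primitives.AlphaConsts L (Summit.QuantumFields.Balaban3D.Carriers.suGroupModel 2).N,
      ∃ ε₁ : ℝ, 0 < ε₁ ∧ ∃ a : ℝ, 0 < a ∧ ∀ (ε₀ : ℝ), 0 < ε₀ → ε₀ ≤ ε₁ → ∀ (b₀ p₀ : ℝ), 0 < b₀ → 2 < p₀ →
        ∃ γ₁ : ℝ, 0 < γ₁ ∧ ∀ (F : T3Family) (γ : ℝ) (hF : F.L = L), 0 < γ → γ ≤ γ₁ →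
          Summit.QuantumFields.YangMills.Theorems.AlphaInputsT3AC.Of F (hF ▸ 𝔠) →
            ∃ (D : AlphaDataT3 F γ) (C68 : ℝ),
              Literature.MathematicalPhysics.QuantumFieldTheory.Balaban1983to89.T3AlphaInputsACSchemas.AlphaInputsT3AC D b₀ p₀ ε₀ C68 ∧
                TwoRun D b₀ p₀ C68 a := by
  sorry

/-- STUB e1 (L–XL; owner's `stub_minimiserCauchy`; located, UNPRINTED — [Balaban1985Variational] Thm 1 per run, abelian two-spacing [King1986] §4; fed by
19200's carriers where the existence of minimisers is consumed): TWO-CUT-OFF CLOSENESS OF PRINT'S MINIMISERS with exponent `a₁(L)`, m-free and datum-free.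
[cite: Balaban1985Variational, Thm 1 (8)-(10) p.279] -/
theorem stub_minimiserCauchy :
    ∀ (L : ℕ), Odd L → 1 < L → ∃ a₁ : ℝ, 0 < a₁ ∧ ∃ ε₁ : ℝ, 0 < ε₁ ∧ ∀ (ε₀ : ℝ), 0 < ε₀ → ε₀ ≤ ε₁ → ∀ (b₀ p₀ : ℝ), 0 < b₀ → 2 < p₀ →
      ∃ γ₁ : ℝ, 0 < γ₁ ∧ ∀ (F : T3Family) (γ : ℝ), F.L = L → 0 < γ → γ ≤ γ₁ → MinimiserCauchyAt F γ ε₀ b₀ p₀ a₁ := by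
  sorry

/-- STUB S-E″ (L–XL BOOKKEEPING incl. e5; owner's `stub_levelCauchyOfSchemas`): for ALL exponents `a, a₁ > 0`, with `m₀ = m₀(L, ε₀, a, a₁)` BEFORE
`b₀ p₀ F γ D` (QUANTIFIER CONTRACT): the minimiser closeness (e1), the per-run package and the two-run bundle of a datum `D` give the cut-off-Cauchy property
`CauchyAtHeights D b₀ p₀ m` — route: `LogComparisonSocketLevelsAlpha.cauchyAtHeights_of_levelwise` (p456396) ⇐ `LogComparisonSocketPolymers.levelCauchyAt_of_polymerwise`
(p458947) ⇐ per polymer `|Pterm′(refine Y)(Umin′) − Pterm Y(Umin) − c| ≤ [PolymerCauchyBgAt at coarsen Umin′] + [PtermLipschitz × (e1 distance)]`, e5 =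
`PtermLipschitz` at level 1 of run `K+1` against the constant background, `m₀` via `LogComparisonBudget.exists_m₀_summable_two_rate_rpow` (p453126).
[cite: King1986, Thm 3.4 (3.9) p.656 and (3.12)-(3.13) p.657] -/
theorem stub_levelCauchyOfSchemas :
    ∀ (L : ℕ), Odd L → 1 < L → ∀ (a a₁ : ℝ), 0 < a → 0 < a₁ →
      ∃ ε₁ : ℝ, 0 < ε₁ ∧ ∀ (ε₀ : ℝ), 0 < ε₀ → ε₀ ≤ ε₁ → ∃ m₀ : ℕ, ∀ (m : ℕ), m₀ ≤ m → ∀ (b₀ p₀ : ℝ), 0 < b₀ → 2 < p₀ →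
        ∃ γ₁ : ℝ, 0 < γ₁ ∧ ∀ (F : T3Family) (γ : ℝ), F.L = L → 0 < γ → γ ≤ γ₁ →
          MinimiserCauchyAt F γ ε₀ b₀ p₀ a₁ →
            ∀ (D : AlphaDataT3 F γ) (C68 : ℝ),
              Literature.MathematicalPhysics.QuantumFieldTheory.Balaban1983to89.T3AlphaInputsACSchemas.AlphaInputsT3AC D b₀ p₀ ε₀ C68 →
                TwoRun D b₀ p₀ C68 a → CauchyAtHeights D b₀ p₀ m := by
  sorry

/-- STUB 6 — SMALL-BLOCK SUPPLEMENT (rank-last; XL; located-UNPRINTED; owner ruling g16-№1 = director R180-amended (iii)(c) «per-stub L-hypotheses +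
a rank-last small-L node», kept at SKELETON level because 19201 is already a second-layer item (D-0019: no third layer)): THE REGISTERED STUB-3 TEXT OF
v2–v4 (`stub_logComparisonRegPr`, body byte-identical) ON odd `L < 7`, i.e. L ∈ {3, 5} — the block sizes at which the large-L line of stubs 2–5 cannot
run AS TYPED: the socket's lower representation `RepAtHeights` (window `PlaqSmall (θBal n) V` on the DATA, at every height) + `IsLocal` + `TermSize` is
unsatisfiable on the window's EDGE BAND `{θBal n/(κ_min√L) < sup-plaquette < θBal n}` (action-minimising one-step lift: κ_min^{lin}(3)·√3 = 1.66,
κ_min^{lin}(5)·√5 = 1.08, two independent codes, kit j257288/j257395; the deep-tower gain at L = 3 stays ≈ 1.6, j257805/j257906/j257907; L = 5 depth 2 =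
j258023 pending — if its gain·√5 < 1, L = 5 needs only the height guard R0; FINDING #44 → #56 90a039633bc1fbfc on stmt-QuantumFields-19201), whereas
print's (47) carries χ_k on the MINIMISER ([Balaban1985UV3] (37) p.265 / (47) p.267) and the d = 3 chain CMP 95–102 takes «L = 2 or 3» (letter (A); lit
g10 17:43:58Z + 19:03:13Z: no printed estimate used by this route needs a block-size floor, and [B13] (2.36) is invoked nowhere in route `UnitScaleTilt` —
the `7 ≤ L` of STUB 3a₂ is OUR TYPING'S consistency range, not print's letter).  THE LINE FORESEEN (owner's order of preference; nothing typed until a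
seat is assigned): (R1) print's χ back — the lower inequality only on `{χ = 1}` (composite minimiser inside the windows with margin at every constrained
level), exposed as a datum schema tied to `Umin`, the two-run comparison on `{χ = 1} ∩ {χ′ = 1}`, PLUS an edge-band clause comparing the two runs'
`log ρ + bg` on `{PlaqSmall (θBal n)} ∖ {χ = 1}` (the penalty is governed by the top step's conditional geometry, common to runs K and K+1 — FINDING §2;
located-unprinted); (R2′) the same through the shrunken window `PlaqSmall (θBal n / C_L) V`, C_3 ≳ 1.7, C_5 ≳ 1.1, INSIDE this stub's proof (the route
decls are NOT re-windowed: 19201's event stays `PlaqSmall (θBal n) V`, so R2 at item level would restate three items — declined); (R0) the height guard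
(representation only at the crux's heights `n = ⌊K/m⌋`) rides the next socket successor module in either case.  NOT part of this stub: positivity / (L1)
(`stub_oneStepSmallLift` covers every L — closed form odd L ≥ 5 via p458893, kernel certificates L = 3 p458270/p460473, L = 5 p459489).  Not staffed
before the large-L chain closes; a partial result for one block size lands `--supports stmt-QuantumFields-19201`.  If the human later ADOPTS the
admissible-block leaf `T3YM3TorusStatement.YM3TorusSU2Adm` (p460222, «∀ L₀, Odd L₀ → 11 < L₀ → …»; director R180-amended: not recommended on today's
evidence) this stub is DROPPED and §2 loses its case split — nothing else moves.
[cite: Balaban1985UV3, (47) p.267; King1986, Thm 3.4 (3.9) p.656] -/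
theorem stub_logComparisonSmallBlocks :
    ∀ (L : ℕ), Odd L → 1 < L → L < 7 →
      ∃ ε₁ : ℝ, 0 < ε₁ ∧ ∀ (ε₀ : ℝ), 0 < ε₀ → ε₀ ≤ ε₁ → ∃ m₀ : ℕ, ∀ (m : ℕ), m₀ ≤ m → ∀ (b₀ p₀ : ℝ), 0 < b₀ → 2 < p₀ →
        ∃ γ₁ : ℝ, 0 < γ₁ ∧ ∀ (F : T3Family) (γ : ℝ), F.L = L → 0 < γ → γ ≤ γ₁ →
          ∃ (r κ : ℕ → ℝ), Summable r ∧ (∀ K, 0 ≤ r K) ∧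
            ∀ K, ∀ᵐ V ∂fieldMeasure (F.P (K / m)) 0 (Matrix.specialUnitaryGroup (Fin 2) ℂ),
              PlaqSmall (θBal F.L γ b₀ p₀ (K / m)) V →
                0 < heightDensity F γ (Nat.div_le_self K m) (histGood F ℰp (θBal F.L γ b₀ p₀) K (K / m)) V →
                0 < heightDensity F γ ((Nat.div_le_self K m).trans (Nat.le_succ K))
                      (histGood F ℰp (θBal F.L γ b₀ p₀) (K + 1) (K / m)) V →
                  |(Real.log (heightDensity F γ ((Nat.div_le_self K m).trans (Nat.le_succ K))
                        (histGood F ℰp (θBal F.L γ b₀ p₀) (K + 1) (K / m)) V) + bgRegPr' F γ m ε₀ K V) -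
                    (Real.log (heightDensity F γ (Nat.div_le_self K m) (histGood F ℰp (θBal F.L γ b₀ p₀) K (K / m)) V) + bgRegPr F γ m ε₀ K V) -
                      κ K| ≤ r K := by
  sorry

/-! ## §2 The composition — NO sorry below this line; v2–v4's STUB 3 `stub_logComparisonRegPr` (text byte-identical) is now the THEOREM `logComparisonRegPr` (renamed so the registrar does not resurrect it as a stub, cf. 19200 v3d) -/

/-- The registered STUB 3 of v2–v4 (888 chars, statement byte-identical; v5b/v5c THEOREM): from the five stubs — for each `L`: the constants record
`𝔠` (lane), `ε₁, a` (α⁺), `a₁` (e1), then S-E″ at `(a, a₁)` gives `m₀(L, ε₀)`; for each family: `D, C68` with the package (hence `RepAtHeights`) and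
`TwoRun`, e1's `MinimiserCauchyAt`, S-E″'s `CauchyAtHeights`; then the per-family socket `LogComparisonSocket.stubBody_of_rep_of_cauchy` (p452026); for odd `L < 7` (L ∈ {3, 5}) it is STUB 6 verbatim (owner ruling g16-№1).
[cite: King1986, Thm 3.4 (3.9) p.656] -/
theorem logComparisonRegPr :
    ∀ (L : ℕ), Odd L → 1 < L →
      ∃ ε₁ : ℝ, 0 < ε₁ ∧ ∀ (ε₀ : ℝ), 0 < ε₀ → ε₀ ≤ ε₁ → ∃ m₀ : ℕ, ∀ (m : ℕ), m₀ ≤ m → ∀ (b₀ p₀ : ℝ), 0 < b₀ → 2 < p₀ →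
        ∃ γ₁ : ℝ, 0 < γ₁ ∧ ∀ (F : T3Family) (γ : ℝ), F.L = L → 0 < γ → γ ≤ γ₁ →
          ∃ (r κ : ℕ → ℝ), Summable r ∧ (∀ K, 0 ≤ r K) ∧
            ∀ K, ∀ᵐ V ∂fieldMeasure (F.P (K / m)) 0 (Matrix.specialUnitaryGroup (Fin 2) ℂ),
              PlaqSmall (θBal F.L γ b₀ p₀ (K / m)) V →
                0 < heightDensity F γ (Nat.div_le_self K m) (histGood F ℰp (θBal F.L γ b₀ p₀) K (K / m)) V →
                0 < heightDensity F γ ((Nat.div_le_self K m).trans (Nat.le_succ K))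
                      (histGood F ℰp (θBal F.L γ b₀ p₀) (K + 1) (K / m)) V →
                  |(Real.log (heightDensity F γ ((Nat.div_le_self K m).trans (Nat.le_succ K))
                        (histGood F ℰp (θBal F.L γ b₀ p₀) (K + 1) (K / m)) V) + bgRegPr' F γ m ε₀ K V) -
                    (Real.log (heightDensity F γ (Nat.div_le_self K m) (histGood F ℰp (θBal F.L γ b₀ p₀) K (K / m)) V) + bgRegPr F γ m ε₀ K V) -
                      κ K| ≤ r K := by
  intro L hLo hL
  by_cases h7 : 7 ≤ L
  swap
  · exact stub_logComparisonSmallBlocks L hLo hL (not_le.mp h7)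
  obtain ⟨𝔠, h𝔠⟩ := stub_laneInputsT3 L hLo hL
  obtain ⟨εa, hεa, a, ha, hA⟩ := stub_alphaTwoRunOfLane L hLo h7 𝔠
  obtain ⟨a₁, ha₁, εe, hεe, hE⟩ := stub_minimiserCauchy L hLo hL
  obtain ⟨εs, hεs, hS⟩ := stub_levelCauchyOfSchemas L hLo hL a a₁ ha ha₁
  refine ⟨min εa (min εe εs), lt_min hεa (lt_min hεe hεs), fun ε₀ h0 h1 => ?_⟩
  have h1a : ε₀ ≤ εa := h1.trans (min_le_left _ _)
  have h1e : ε₀ ≤ εe := h1.trans ((min_le_right _ _).trans (min_le_left _ _))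
  have h1s : ε₀ ≤ εs := h1.trans ((min_le_right _ _).trans (min_le_right _ _))
  obtain ⟨m₀, hm₀⟩ := hS ε₀ h0 h1s
  refine ⟨max m₀ 1, fun m hm b₀ p₀ hb hp => ?_⟩
  have hmpos : 0 < m := Nat.lt_of_lt_of_le Nat.one_pos ((le_max_right _ _).trans hm)
  obtain ⟨γa, hγa, hA'⟩ := hA ε₀ h0 h1a b₀ p₀ hb hp
  obtain ⟨γe, hγe, hE'⟩ := hE ε₀ h0 h1e b₀ p₀ hb hp
  obtain ⟨γs, hγs, hS'⟩ := hm₀ m ((le_max_left _ _).trans hm) b₀ p₀ hb hp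
  refine ⟨min γa (min γe γs), lt_min hγa (lt_min hγe hγs), fun F γ hF hγ hγ₁ => ?_⟩
  have hγa' : γ ≤ γa := hγ₁.trans (min_le_left _ _)
  have hγe' : γ ≤ γe := hγ₁.trans ((min_le_right _ _).trans (min_le_left _ _))
  have hγs' : γ ≤ γs := hγ₁.trans ((min_le_right _ _).trans (min_le_right _ _))
  obtain ⟨D, C68, hPkg, hTwo⟩ := hA' F γ hF hγ hγa' (h𝔠 F hF)
  have hMin := hE' F γ hF hγ hγe'
  have hCau : CauchyAtHeights D b₀ p₀ m := hS' F γ hF hγ hγs' hMin D C68 hPkg hTwo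
  exact Summit.QuantumFields.YangMills.Theorems.LogComparisonSocket.stubBody_of_rep_of_cauchy F γ b₀ p₀ ε₀ hmpos
    D.PintH D.EcstH D.RmH hPkg.repAtHeights hCau

/-- The old registered `stub_posOnSmall` (birth 04793f26c2da46ec), now a THEOREM modulo stub 1 ALONE (statement verbatim; «Lemma B» landed). -/
theorem posOnSmall :
    ∀ (L m : ℕ), 0 < m → ∀ (b₀ p₀ : ℝ), 0 < b₀ → 2 < p₀ → ∃ γ₁ : ℝ, 0 < γ₁ ∧
      ∀ (F : T3Family) (γ : ℝ), F.L = L → 0 < γ → γ ≤ γ₁ →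
        ∀ K, ∀ᵐ V ∂fieldMeasure (F.P (K / m)) 0 (Matrix.specialUnitaryGroup (Fin 2) ℂ),
          PlaqSmall (θBal F.L γ b₀ p₀ (K / m)) V →
            0 < heightDensity F γ (Nat.div_le_self K m) (histGood F ℰp (θBal F.L γ b₀ p₀) K (K / m)) V ∧
            0 < heightDensity F γ ((Nat.div_le_self K m).trans (Nat.le_succ K))
                  (histGood F ℰp (θBal F.L γ b₀ p₀) (K + 1) (K / m)) V :=
  Summit.QuantumFields.YangMills.Theorems.PosOnSmallReduction.posOnSmall_of_smallLift_of_oneStepSubmersion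
    stub_oneStepSmallLift landed_oneStepSubmersion

/-- **`FluctuationComparisonRegPr ⇐ stub_oneStepSmallLift ∧ stub_laneInputsT3 ∧ stub_alphaTwoRunOfLane ∧ stub_minimiserCauchy ∧ stub_levelCauchyOfSchemas ∧ stub_logComparisonSmallBlocks`** (+ landed p446430 ∘ p443013 ∘ p428548 for positivity; p452026 for the fluctuation comparison). -/
theorem FluctuationComparisonRegPr_of : Summit.QuantumFields.YangMills.Theses.UnitScaleTilt.FluctuationComparisonRegPr := by
  intro L
  by_cases hL : Odd L ∧ 1 < L
  · obtain ⟨ε₁, hε₁, hε⟩ := logComparisonRegPr L hL.1 hL.2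
    refine ⟨ε₁, hε₁, fun ε₀ h0 h1 => ?_⟩
    obtain ⟨m₀, hm₀⟩ := hε ε₀ h0 h1
    refine ⟨max m₀ 1, fun m hm b₀ p₀ hb hp => ?_⟩
    have hm₀' : m₀ ≤ m := (le_max_left _ _).trans hm
    have hmpos : 0 < m := Nat.lt_of_lt_of_le Nat.one_pos ((le_max_right _ _).trans hm)
    obtain ⟨γa, hγa, ha⟩ := posOnSmall L m hmpos b₀ p₀ hb hp
    obtain ⟨γb, hγb, hb'⟩ := hm₀ m hm₀' b₀ p₀ hb hp
    refine ⟨min γa γb, lt_min hγa hγb, fun F γ hFL hγ hγ₁ => ?_⟩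
    have hP := ha F γ hFL hγ (hγ₁.trans (min_le_left _ _))
    obtain ⟨r, κ, hr, hr0, hC⟩ := hb' F γ hFL hγ (hγ₁.trans (min_le_right _ _))
    refine ⟨r, κ, hr, hr0, fun K => ?_⟩
    filter_upwards [hP K, hC K] with V hVp hVc
    intro hs
    obtain ⟨h0', h1'⟩ := hVp hs
    exact ⟨h0', h1', hVc hs h0' h1'⟩
  · refine ⟨1, one_pos, fun ε₀ _ _ => ⟨0, fun m _ b₀ p₀ _ _ => ⟨1, one_pos, fun F γ hFL _ _ => ?_⟩⟩⟩
    have hF := F.hL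
    rw [hFL] at hF
    exact (hL hF).elim

end Summit.QuantumFields.YangMills.Cruxes.FluctuationComparisonRegPr.BirthV5d

end
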